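/-
Copyright (c) 2026 the pub-hodgecm-mathlib formalisation cell (harness21).  Prover seat hodgecm-mathlib-F0P2-p08 (g0) (re-dealt to L1 `stub_firstTermThetaPairing` by
director s1970; LEAD F0P6-plan (g14) EMIT #1 slot `p19`, BATCH #39): Track B «K2-LIT», hLiu418 = stmt-HodgeConjecture-24832, road `K2_Liu`, socket #42S, organ S4,
(asm-3G) local letter (L-Kfin): LOCAL SIEGEL–WEIL SECTIONS ARE `K_v`-FINITE — finitely many right translates by any compact subset of `H(L⁺_v)`, finite-dimensional
span (sequel of ★ p861068 `K2LiuLocalSWSectionSmooth`, K2Liu-p03 (g7)).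
-/
import Summits.HodgeConjecture.HodgeConjecture.Theorems.K2LiuLocalSWSectionSmooth   -- ★ p861068 (asm-3G) G1: `exists_isOpen_forall_mul_eq_of_mem_localSWImage(_rec)`, `isSmooth_finSplittings_rec`
import HarnessLib

/-!
# Crux `HLiu418`, road `K2_Liu`, socket #42S, organ S4, (asm-3G) local letter (L-Kfin): local Siegel–Weil sections are `K_v`-finite

Cell `hodgecm-mathlib`, crux item hLiu418 = `stmt-HodgeConjecture-24832`; squad K2 ∕ K2Liu (L1 `stub_firstTermThetaPairing`, LEAD F0P6-plan (g14)); prover F0P2-p08 (g0).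
THEOREMS ONLY (no `def`, no instance, no notation, no named-fact hypothesis, no `sorry`); lane `--supports stmt-HodgeConjecture-24832 --as helper`.

★ p861068 `K2LiuLocalSWSectionSmooth` (G1) proves that every element `b` of a local Siegel–Weil image `R(V′_v) = localSWImage … v s m₀` (`ω_v = toRep ∘ s` smooth) is
right-invariant under an OPEN subgroup `U ≤ H(L⁺_v)`.  This sequel records the other local letter of LEAD BATCH #33 (1): such a `b` has only FINITELY MANY right translates
`u ↦ b (u k)` as `k` ranges over any compact subset of `H(L⁺_v)` — in particular over any compact subgroup `K_v` (the `v`-component of a standard maximal compact) — so the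
`ℂ`-span of these translates is FINITE-DIMENSIONAL (and lies in `R(V′_v)`, ★ `span_rightTranslates_le_localSWImage`).  The mechanism is the folklore one: `k ↦ b(· k)` is
constant on the open cosets `k·U`, and a compact set meets only finitely many of them.
* §1 (generic, any topological group `G`, any `U ≤ G` open, any `f : G → X` with `f (g u) = f g`): `isLocallyConstant_rightTranslate` (`k ↦ f(· k)` is locally constant),
  `finite_image_rightTranslate_of_isCompact` ∕ `finite_range_rightTranslate_of_isCompact` (finitely many translates over a compact set ∕ a compact subgroup),
  `finiteDimensional_span_image_rightTranslate_of_isCompact` ∕ `finiteDimensional_span_range_rightTranslate_of_isCompact` (module-valued `f`, any division ring).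
* §2 (generic smooth local splitting `s`, `hs : IsSmooth (toRep ∘ s)`): `isSmooth_of_mem_localSWImage` (the K2Lit currency ★ `LocalSiegelDoubled.IsSmooth` of ★ `localDegPS`,
  i.e. the `hsm` input of ★ `localSWImage_le_localDegPS`), `finite_image_rightTranslate_of_mem_localSWImage`, `finite_range_rightTranslate_of_mem_localSWImage`,
  `finiteDimensional_span_rightTranslate_of_mem_localSWImage`.
* §3 the record data `finSplittings … (cmFinLocalFamily …)` (★ `isSmooth_finSplittings_rec`): the `_rec` corollaries of §2.
[MoeglinVignerasWaldspurger1987, Chap. 2 II.1 (smooth vectors of `ω_ψ`)]; [KudlaRallis1994, §1 (`K`-finite standard sections)]; [HarrisKudlaSweet1996, §1 (1.15)–(1.16)];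
[BorelJacquet1979, §4.1 (admissibility: open compact level ⇒ `K`-finite)].
HONEST LABEL.  Count-neutral helper: `HC_CM` is proved only modulo the 7 printed citations (2 remaining named inputs: hLiu418 = `stmt-HodgeConjecture-24832`,
h413 = `stmt-HodgeConjecture-24833`) until rung 0 closes.
-/

set_option autoImplicit false
set_option linter.dupNamespace false -- the mandated namespace repeats `HodgeConjecture.HodgeConjecture`

noncomputable section

open scoped Matrix TensorProduct Classical
open NumberField IsDedekindDomain Filter Topology
open Literature.RepresentationTheory.HeisenbergGroup
open Literature.NumberTheory.Automorphic Literature.NumberTheory.Automorphic.UnitaryGroup Literature.NumberTheory.GaloisRepresentations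
open Literature.NumberTheory.Weil1964 Literature.RepresentationTheory.HarrisKudlaSweet1996
open Literature.NumberTheory.GelbartRogawski1991 Literature.NumberTheory.GelbartRogawski1991.GRConstruction Literature.NumberTheory.GelbartRogawski1991.UnitaryDualPair
open Literature.NumberTheory.GelbartRogawski1991.UnitaryDualPair.LocalSplitting
open Literature.NumberTheory.K2Lit.SiegelDoubled Literature.NumberTheory.K2Lit.LocalSiegelDoubled
open Summit.HodgeConjecture.HodgeConjecture.Cruxes.HLiu418.K2LiuLocalSWSectionDefs Summit.HodgeConjecture.HodgeConjecture.Cruxes.HLiu418.K2LiuLocalSWImageDefs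
open Summit.HodgeConjecture.HodgeConjecture.Cruxes.HLiu418.K2LiuSWSectionPlaceFactorisation
open Summit.HodgeConjecture.HodgeConjecture.Cruxes.HLiu418.K2LiuLocalSWSectionSmooth

namespace Summit.HodgeConjecture.HodgeConjecture.Cruxes.HLiu418.K2LiuLocalSWSectionKFinite

/-! ## §1 Right-invariance under an open subgroup ⇒ finitely many right translates over a compact set -/

/-- if `f (g u) = f g` for all `u` in an OPEN subgroup `U`, the right-translation map `k ↦ (g ↦ f (g k))` is locally constant on `G` (constant on the open cosets
`k·U`). [folklore] [cite: BorelJacquet1979, §4.1] -/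
theorem isLocallyConstant_rightTranslate {G X : Type*} [Group G] [TopologicalSpace G] [ContinuousMul G] (U : Subgroup G) (hU : IsOpen (U : Set G))
    (f : G → X) (hf : ∀ g, ∀ u ∈ U, f (g * u) = f g) : IsLocallyConstant fun k : G => fun g : G => f (g * k) := by
  refine (IsLocallyConstant.iff_eventually_eq _).2 fun k => ?_
  have hopen : IsOpen ((fun y => k⁻¹ * y) ⁻¹' (U : Set G)) := hU.preimage (continuous_const.mul continuous_id)
  have hk : k ∈ (fun y => k⁻¹ * y) ⁻¹' (U : Set G) := by simp
  filter_upwards [hopen.mem_nhds hk] with y hy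
  funext g
  have h1 := hf (g * k) (k⁻¹ * y) hy
  rwa [mul_assoc, mul_inv_cancel_left] at h1

/-- **finitely many right translates over a compact set**: if `f (g u) = f g` for `u` in an open subgroup `U` and `C ⊆ G` is compact, the set of right translates
`{g ↦ f (g k) : k ∈ C}` is finite (a locally constant map has finite range on a compact space). [folklore] [cite: BorelJacquet1979, §4.1] -/
theorem finite_image_rightTranslate_of_isCompact {G X : Type*} [Group G] [TopologicalSpace G] [ContinuousMul G] (U : Subgroup G) (hU : IsOpen (U : Set G))
    (f : G → X) (hf : ∀ g, ∀ u ∈ U, f (g * u) = f g) {C : Set G} (hC : IsCompact C) :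
    ((fun k : G => fun g : G => f (g * k)) '' C).Finite := by
  haveI : CompactSpace C := isCompact_iff_compactSpace.mp hC
  rw [Set.image_eq_range]
  exact ((isLocallyConstant_rightTranslate U hU f hf).comp_continuous continuous_subtype_val).range_finite

/-- **finitely many right translates over a compact subgroup** `K ≤ G` (e.g. a maximal compact): the family `k : K ↦ (g ↦ f (g k))` has finite range.
[folklore] [cite: BorelJacquet1979, §4.1] -/
theorem finite_range_rightTranslate_of_isCompact {G X : Type*} [Group G] [TopologicalSpace G] [ContinuousMul G] (U : Subgroup G) (hU : IsOpen (U : Set G))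
    (f : G → X) (hf : ∀ g, ∀ u ∈ U, f (g * u) = f g) (K : Subgroup G) (hK : IsCompact (K : Set G)) :
    (Set.range fun k : K => fun g : G => f (g * (k : G))).Finite := by
  refine (finite_image_rightTranslate_of_isCompact U hU f hf hK).subset ?_
  rintro _ ⟨k, rfl⟩
  exact ⟨(k : G), k.2, rfl⟩

/-- **finite-dimensional span (compact set)**: for a module-valued `f` right-invariant under an open subgroup, the span of the right translates over a compact set
is finite-dimensional. [folklore] [cite: BorelJacquet1979, §4.1] [cite: HarrisKudlaSweet1996, §1 (1.16)] -/
theorem finiteDimensional_span_image_rightTranslate_of_isCompact {G : Type*} [Group G] [TopologicalSpace G] [ContinuousMul G] {𝕜 V : Type*} [DivisionRing 𝕜]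
    [AddCommGroup V] [Module 𝕜 V] (U : Subgroup G) (hU : IsOpen (U : Set G)) (f : G → V) (hf : ∀ g, ∀ u ∈ U, f (g * u) = f g) {C : Set G} (hC : IsCompact C) :
    FiniteDimensional 𝕜 (Submodule.span 𝕜 ((fun k : G => fun g : G => f (g * k)) '' C)) :=
  FiniteDimensional.span_of_finite 𝕜 (finite_image_rightTranslate_of_isCompact U hU f hf hC)

/-- **finite-dimensional span (compact subgroup)**: the span of `{g ↦ f (g k) : k ∈ K}` is finite-dimensional for every compact subgroup `K ≤ G`.
[folklore] [cite: BorelJacquet1979, §4.1] [cite: HarrisKudlaSweet1996, §1 (1.16)] -/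
theorem finiteDimensional_span_range_rightTranslate_of_isCompact {G : Type*} [Group G] [TopologicalSpace G] [ContinuousMul G] {𝕜 V : Type*} [DivisionRing 𝕜]
    [AddCommGroup V] [Module 𝕜 V] (U : Subgroup G) (hU : IsOpen (U : Set G)) (f : G → V) (hf : ∀ g, ∀ u ∈ U, f (g * u) = f g) (K : Subgroup G)
    (hK : IsCompact (K : Set G)) :
    FiniteDimensional 𝕜 (Submodule.span 𝕜 (Set.range fun k : K => fun g : G => f (g * (k : G)))) :=
  FiniteDimensional.span_of_finite 𝕜 (finite_range_rightTranslate_of_isCompact U hU f hf K hK)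

variable (L : Type) [Field L] [NumberField L] [IsCMField L]
variable {N M n : ℕ} (e : Fin N × Fin M ≃ Fin n)
  (dV : Fin N → L) (hdV : ∀ i, IsCMField.complexConj L (dV i) = dV i) (hdV0 : ∀ i, dV i ≠ 0)
  (dW : Fin M → L) (hdW : ∀ i, IsCMField.complexConj L (dW i) = dW i) (hdW0 : ∀ i, dW i ≠ 0)
variable {M₂ M' n' : ℕ} (eW : Fin M × Fin M₂ ≃ Fin M') (e' : Fin N × Fin M' ≃ Fin n')
  (dV' : Fin M₂ → L) (hdV' : ∀ k, IsCMField.complexConj L (dV' k) = dV' k) (hdV'0 : ∀ k, dV' k ≠ 0)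

/-! ## §2 A smooth local splitting: elements of the local Siegel–Weil image are smooth and `K_v`-finite -/

/-- **SMOOTH IN THE K2Lit CURRENCY**: for a local splitting `s` with `ω_v = toRep ∘ s` smooth, every `b ∈ R(V′_v) = localSWImage … v s m₀` is ★ `LocalSiegelDoubled.IsSmooth`
(right-invariant under an open subgroup, packaged as an `OpenSubgroup`) — the `hsm` input of ★ `localSWImage_le_localDegPS`. [cite: MoeglinVignerasWaldspurger1987, Chap. 2 II.1]
[cite: HarrisKudlaSweet1996, §1 (1.15)] -/
theorem isSmooth_of_mem_localSWImage (v : HeightOneSpectrum (𝓞 (Fp L)))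
    (s : UnitaryGroup.localPi L (IsCMField.complexConj L) (n' + n') (hermD L e' dV hdV (tensorFrame L dW eW dV') (tensorFrame_real L dW hdW eW dV' hdV')) v →* LocalMp (Fp L) (n' + n') (gramD L e' dV hdV (tensorFrame L dW eW dV') (tensorFrame_real L dW hdW eW dV' hdV')) v)
    (hs : Representation.IsSmooth ((MpPsi.toRep (localSchrodinger (Fp L) (n' + n') (gramD L e' dV hdV (tensorFrame L dW eW dV') (tensorFrame_real L dW hdW eW dV' hdV')) v)).comp s))
    (m₀ : LocalMp (Fp L) (n' + n') (gramD L e' dV hdV (tensorFrame L dW eW dV') (tensorFrame_real L dW hdW eW dV' hdV')) v) {b : UnitaryGroup.localPi L (IsCMField.complexConj L) (n + n) (hermD L e dV hdV dW hdW) v → ℂ} (hb : b ∈ localSWImage L e dV hdV dW hdW eW e' dV' hdV' v s m₀) :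
    Literature.NumberTheory.K2Lit.LocalSiegelDoubled.IsSmooth (Fp L) L (IsCMField.complexConj L) v n b := by
  obtain ⟨U, hU, hUeq⟩ := exists_isOpen_forall_mul_eq_of_mem_localSWImage L e dV hdV dW hdW eW e' dV' hdV' v s hs m₀ hb
  exact ⟨⟨U, hU⟩, fun h u hu => hUeq h u hu⟩

/-- **FINITELY MANY RIGHT TRANSLATES OVER A COMPACT SET**: for `b ∈ R(V′_v)` (smooth `s`) and a compact `C ⊆ H(L⁺_v)`, `{u ↦ b (u k) : k ∈ C}` is finite.
[cite: BorelJacquet1979, §4.1] [cite: KudlaRallis1994, §1] -/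
theorem finite_image_rightTranslate_of_mem_localSWImage (v : HeightOneSpectrum (𝓞 (Fp L)))
    (s : UnitaryGroup.localPi L (IsCMField.complexConj L) (n' + n') (hermD L e' dV hdV (tensorFrame L dW eW dV') (tensorFrame_real L dW hdW eW dV' hdV')) v →* LocalMp (Fp L) (n' + n') (gramD L e' dV hdV (tensorFrame L dW eW dV') (tensorFrame_real L dW hdW eW dV' hdV')) v)
    (hs : Representation.IsSmooth ((MpPsi.toRep (localSchrodinger (Fp L) (n' + n') (gramD L e' dV hdV (tensorFrame L dW eW dV') (tensorFrame_real L dW hdW eW dV' hdV')) v)).comp s))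
    (m₀ : LocalMp (Fp L) (n' + n') (gramD L e' dV hdV (tensorFrame L dW eW dV') (tensorFrame_real L dW hdW eW dV' hdV')) v) {b : UnitaryGroup.localPi L (IsCMField.complexConj L) (n + n) (hermD L e dV hdV dW hdW) v → ℂ} (hb : b ∈ localSWImage L e dV hdV dW hdW eW e' dV' hdV' v s m₀)
    {C : Set (UnitaryGroup.localPi L (IsCMField.complexConj L) (n + n) (hermD L e dV hdV dW hdW) v)} (hC : IsCompact C) :
    ((fun k : UnitaryGroup.localPi L (IsCMField.complexConj L) (n + n) (hermD L e dV hdV dW hdW) v =>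
        fun u : UnitaryGroup.localPi L (IsCMField.complexConj L) (n + n) (hermD L e dV hdV dW hdW) v => b (u * k)) '' C).Finite := by
  obtain ⟨U, hU, hUeq⟩ := exists_isOpen_forall_mul_eq_of_mem_localSWImage L e dV hdV dW hdW eW e' dV' hdV' v s hs m₀ hb
  exact finite_image_rightTranslate_of_isCompact U hU b hUeq hC

/-- **FINITELY MANY RIGHT `K_v`-TRANSLATES**: for `b ∈ R(V′_v)` (smooth `s`) and a compact subgroup `K_v ≤ H(L⁺_v)`, the family `k : K_v ↦ (u ↦ b (u k))` has finite range.
[cite: BorelJacquet1979, §4.1] [cite: KudlaRallis1994, §1] -/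
theorem finite_range_rightTranslate_of_mem_localSWImage (v : HeightOneSpectrum (𝓞 (Fp L)))
    (s : UnitaryGroup.localPi L (IsCMField.complexConj L) (n' + n') (hermD L e' dV hdV (tensorFrame L dW eW dV') (tensorFrame_real L dW hdW eW dV' hdV')) v →* LocalMp (Fp L) (n' + n') (gramD L e' dV hdV (tensorFrame L dW eW dV') (tensorFrame_real L dW hdW eW dV' hdV')) v)
    (hs : Representation.IsSmooth ((MpPsi.toRep (localSchrodinger (Fp L) (n' + n') (gramD L e' dV hdV (tensorFrame L dW eW dV') (tensorFrame_real L dW hdW eW dV' hdV')) v)).comp s))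
    (m₀ : LocalMp (Fp L) (n' + n') (gramD L e' dV hdV (tensorFrame L dW eW dV') (tensorFrame_real L dW hdW eW dV' hdV')) v) {b : UnitaryGroup.localPi L (IsCMField.complexConj L) (n + n) (hermD L e dV hdV dW hdW) v → ℂ} (hb : b ∈ localSWImage L e dV hdV dW hdW eW e' dV' hdV' v s m₀)
    (Kv : Subgroup (UnitaryGroup.localPi L (IsCMField.complexConj L) (n + n) (hermD L e dV hdV dW hdW) v))
    (hKv : IsCompact (Kv : Set (UnitaryGroup.localPi L (IsCMField.complexConj L) (n + n) (hermD L e dV hdV dW hdW) v))) :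
    (Set.range fun k : Kv => fun u : UnitaryGroup.localPi L (IsCMField.complexConj L) (n + n) (hermD L e dV hdV dW hdW) v =>
        b (u * (k : UnitaryGroup.localPi L (IsCMField.complexConj L) (n + n) (hermD L e dV hdV dW hdW) v))).Finite := by
  obtain ⟨U, hU, hUeq⟩ := exists_isOpen_forall_mul_eq_of_mem_localSWImage L e dV hdV dW hdW eW e' dV' hdV' v s hs m₀ hb
  exact finite_range_rightTranslate_of_isCompact U hU b hUeq Kv hKv

/-- **`K_v`-FINITENESS OF THE LOCAL SIEGEL–WEIL SECTIONS**: for `b ∈ R(V′_v)` (smooth `s`) and a compact subgroup `K_v ≤ H(L⁺_v)`, the `ℂ`-span of the right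
`K_v`-translates of `b` is finite-dimensional (it lies in `R(V′_v)` by ★ `span_rightTranslates_le_localSWImage`). [cite: KudlaRallis1994, §1] [cite: HarrisKudlaSweet1996, §1 (1.16)]
[cite: BorelJacquet1979, §4.1] -/
theorem finiteDimensional_span_rightTranslate_of_mem_localSWImage (v : HeightOneSpectrum (𝓞 (Fp L)))
    (s : UnitaryGroup.localPi L (IsCMField.complexConj L) (n' + n') (hermD L e' dV hdV (tensorFrame L dW eW dV') (tensorFrame_real L dW hdW eW dV' hdV')) v →* LocalMp (Fp L) (n' + n') (gramD L e' dV hdV (tensorFrame L dW eW dV') (tensorFrame_real L dW hdW eW dV' hdV')) v)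
    (hs : Representation.IsSmooth ((MpPsi.toRep (localSchrodinger (Fp L) (n' + n') (gramD L e' dV hdV (tensorFrame L dW eW dV') (tensorFrame_real L dW hdW eW dV' hdV')) v)).comp s))
    (m₀ : LocalMp (Fp L) (n' + n') (gramD L e' dV hdV (tensorFrame L dW eW dV') (tensorFrame_real L dW hdW eW dV' hdV')) v) {b : UnitaryGroup.localPi L (IsCMField.complexConj L) (n + n) (hermD L e dV hdV dW hdW) v → ℂ} (hb : b ∈ localSWImage L e dV hdV dW hdW eW e' dV' hdV' v s m₀)
    (Kv : Subgroup (UnitaryGroup.localPi L (IsCMField.complexConj L) (n + n) (hermD L e dV hdV dW hdW) v))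
    (hKv : IsCompact (Kv : Set (UnitaryGroup.localPi L (IsCMField.complexConj L) (n + n) (hermD L e dV hdV dW hdW) v))) :
    FiniteDimensional ℂ (Submodule.span ℂ (Set.range fun k : Kv => fun u : UnitaryGroup.localPi L (IsCMField.complexConj L) (n + n) (hermD L e dV hdV dW hdW) v =>
        b (u * (k : UnitaryGroup.localPi L (IsCMField.complexConj L) (n + n) (hermD L e dV hdV dW hdW) v)))) :=
  FiniteDimensional.span_of_finite ℂ (finite_range_rightTranslate_of_mem_localSWImage L e dV hdV dW hdW eW e' dV' hdV' v s hs m₀ hb Kv hKv)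

/-! ## §3 The record data -/

variable {χb : HeckeCharacter L} (hχbs : IsSplittingChar L 1 χb)

/-- **record corollary (smooth)**: every element of the record local Siegel–Weil image `R(dV′, v; rec)` is ★ `LocalSiegelDoubled.IsSmooth`.
[cite: MoeglinVignerasWaldspurger1987, Chap. 2 II.1] [cite: HarrisKudlaSweet1996, §1 (1.15)] -/
theorem isSmooth_of_mem_localSWImage_rec (v : HeightOneSpectrum (𝓞 (Fp L))) {b : UnitaryGroup.localPi L (IsCMField.complexConj L) (n + n) (hermD L e dV hdV dW hdW) v → ℂ}
    (hb : b ∈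
      localSWImage L e dV hdV dW hdW eW e' dV' hdV' v ((finSplittings L e' dV hdV hdV0 (tensorFrame L dW eW dV') (tensorFrame_real L dW hdW eW dV' hdV') (tensorFrame_ne_zero L dW eW dV' hdW0 hdV'0) χb (borelPlaceMeasure L) (cmFinLocalFamily L e' dV hdV hdV0 (tensorFrame L dW eW dV') (tensorFrame_real L dW hdW eW dV' hdV') (tensorFrame_ne_zero L dW eW dV' hdW0 hdV'0) χb hχbs (borelPlaceMeasure L))).s v)
        ⟨(ratSpLoc (Fp L) (n' + n') (gramD L e' dV hdV (tensorFrame L dW eW dV') (tensorFrame_real L dW hdW eW dV' hdV'))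
              (isUnit_det_gramD L e' dV hdV hdV0 (tensorFrame L dW eW dV') (tensorFrame_real L dW hdW eW dV' hdV') (tensorFrame_ne_zero L dW eW dV' hdW0 hdV'0)) v (deltaD L),
            deltaImpl L e' dV hdV hdV0 (tensorFrame L dW eW dV') (tensorFrame_real L dW hdW eW dV' hdV') (tensorFrame_ne_zero L dW eW dV' hdW0 hdV'0) χb (borelPlaceMeasure L) (cmFinLocalFamily L e' dV hdV hdV0 (tensorFrame L dW eW dV') (tensorFrame_real L dW hdW eW dV' hdV') (tensorFrame_ne_zero L dW eW dV' hdW0 hdV'0) χb hχbs (borelPlaceMeasure L)) v),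
          deltaPair_mem_localMp L e' dV hdV hdV0 (tensorFrame L dW eW dV') (tensorFrame_real L dW hdW eW dV' hdV') (tensorFrame_ne_zero L dW eW dV' hdW0 hdV'0) χb (borelPlaceMeasure L) (cmFinLocalFamily L e' dV hdV hdV0 (tensorFrame L dW eW dV') (tensorFrame_real L dW hdW eW dV' hdV') (tensorFrame_ne_zero L dW eW dV' hdW0 hdV'0) χb hχbs (borelPlaceMeasure L)) v⟩) :
    Literature.NumberTheory.K2Lit.LocalSiegelDoubled.IsSmooth (Fp L) L (IsCMField.complexConj L) v n b :=
  isSmooth_of_mem_localSWImage L e dV hdV dW hdW eW e' dV' hdV' v _ (isSmooth_finSplittings_rec L dV hdV hdV0 dW hdW hdW0 eW e' dV' hdV' hdV'0 hχbs v) _ hb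

/-- **record corollary (finitely many `K_v`-translates)**: for `b ∈ R(dV′, v; rec)` and a compact subgroup `K_v ≤ H(L⁺_v)`, `k : K_v ↦ (u ↦ b (u k))` has finite range.
[cite: BorelJacquet1979, §4.1] [cite: KudlaRallis1994, §1] -/
theorem finite_range_rightTranslate_of_mem_localSWImage_rec (v : HeightOneSpectrum (𝓞 (Fp L))) {b : UnitaryGroup.localPi L (IsCMField.complexConj L) (n + n) (hermD L e dV hdV dW hdW) v → ℂ}
    (hb : b ∈
      localSWImage L e dV hdV dW hdW eW e' dV' hdV' v ((finSplittings L e' dV hdV hdV0 (tensorFrame L dW eW dV') (tensorFrame_real L dW hdW eW dV' hdV') (tensorFrame_ne_zero L dW eW dV' hdW0 hdV'0) χb (borelPlaceMeasure L) (cmFinLocalFamily L e' dV hdV hdV0 (tensorFrame L dW eW dV') (tensorFrame_real L dW hdW eW dV' hdV') (tensorFrame_ne_zero L dW eW dV' hdW0 hdV'0) χb hχbs (borelPlaceMeasure L))).s v)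
        ⟨(ratSpLoc (Fp L) (n' + n') (gramD L e' dV hdV (tensorFrame L dW eW dV') (tensorFrame_real L dW hdW eW dV' hdV'))
              (isUnit_det_gramD L e' dV hdV hdV0 (tensorFrame L dW eW dV') (tensorFrame_real L dW hdW eW dV' hdV') (tensorFrame_ne_zero L dW eW dV' hdW0 hdV'0)) v (deltaD L),
            deltaImpl L e' dV hdV hdV0 (tensorFrame L dW eW dV') (tensorFrame_real L dW hdW eW dV' hdV') (tensorFrame_ne_zero L dW eW dV' hdW0 hdV'0) χb (borelPlaceMeasure L) (cmFinLocalFamily L e' dV hdV hdV0 (tensorFrame L dW eW dV') (tensorFrame_real L dW hdW eW dV' hdV') (tensorFrame_ne_zero L dW eW dV' hdW0 hdV'0) χb hχbs (borelPlaceMeasure L)) v),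
          deltaPair_mem_localMp L e' dV hdV hdV0 (tensorFrame L dW eW dV') (tensorFrame_real L dW hdW eW dV' hdV') (tensorFrame_ne_zero L dW eW dV' hdW0 hdV'0) χb (borelPlaceMeasure L) (cmFinLocalFamily L e' dV hdV hdV0 (tensorFrame L dW eW dV') (tensorFrame_real L dW hdW eW dV' hdV') (tensorFrame_ne_zero L dW eW dV' hdW0 hdV'0) χb hχbs (borelPlaceMeasure L)) v⟩)
    (Kv : Subgroup (UnitaryGroup.localPi L (IsCMField.complexConj L) (n + n) (hermD L e dV hdV dW hdW) v))
    (hKv : IsCompact (Kv : Set (UnitaryGroup.localPi L (IsCMField.complexConj L) (n + n) (hermD L e dV hdV dW hdW) v))) :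
    (Set.range fun k : Kv => fun u : UnitaryGroup.localPi L (IsCMField.complexConj L) (n + n) (hermD L e dV hdV dW hdW) v =>
        b (u * (k : UnitaryGroup.localPi L (IsCMField.complexConj L) (n + n) (hermD L e dV hdV dW hdW) v))).Finite :=
  finite_range_rightTranslate_of_mem_localSWImage L e dV hdV dW hdW eW e' dV' hdV' v _ (isSmooth_finSplittings_rec L dV hdV hdV0 dW hdW hdW0 eW e' dV' hdV' hdV'0 hχbs v) _ hb Kv hKv

/-- **record corollary (`K_v`-finite)**: for `b ∈ R(dV′, v; rec)` and a compact subgroup `K_v ≤ H(L⁺_v)`, the `ℂ`-span of the right `K_v`-translates of `b` is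
finite-dimensional. [cite: KudlaRallis1994, §1] [cite: HarrisKudlaSweet1996, §1 (1.16)] [cite: BorelJacquet1979, §4.1] -/
theorem finiteDimensional_span_rightTranslate_of_mem_localSWImage_rec (v : HeightOneSpectrum (𝓞 (Fp L))) {b : UnitaryGroup.localPi L (IsCMField.complexConj L) (n + n) (hermD L e dV hdV dW hdW) v → ℂ}
    (hb : b ∈
      localSWImage L e dV hdV dW hdW eW e' dV' hdV' v ((finSplittings L e' dV hdV hdV0 (tensorFrame L dW eW dV') (tensorFrame_real L dW hdW eW dV' hdV') (tensorFrame_ne_zero L dW eW dV' hdW0 hdV'0) χb (borelPlaceMeasure L) (cmFinLocalFamily L e' dV hdV hdV0 (tensorFrame L dW eW dV') (tensorFrame_real L dW hdW eW dV' hdV') (tensorFrame_ne_zero L dW eW dV' hdW0 hdV'0) χb hχbs (borelPlaceMeasure L))).s v)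
        ⟨(ratSpLoc (Fp L) (n' + n') (gramD L e' dV hdV (tensorFrame L dW eW dV') (tensorFrame_real L dW hdW eW dV' hdV'))
              (isUnit_det_gramD L e' dV hdV hdV0 (tensorFrame L dW eW dV') (tensorFrame_real L dW hdW eW dV' hdV') (tensorFrame_ne_zero L dW eW dV' hdW0 hdV'0)) v (deltaD L),
            deltaImpl L e' dV hdV hdV0 (tensorFrame L dW eW dV') (tensorFrame_real L dW hdW eW dV' hdV') (tensorFrame_ne_zero L dW eW dV' hdW0 hdV'0) χb (borelPlaceMeasure L) (cmFinLocalFamily L e' dV hdV hdV0 (tensorFrame L dW eW dV') (tensorFrame_real L dW hdW eW dV' hdV') (tensorFrame_ne_zero L dW eW dV' hdW0 hdV'0) χb hχbs (borelPlaceMeasure L)) v),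
          deltaPair_mem_localMp L e' dV hdV hdV0 (tensorFrame L dW eW dV') (tensorFrame_real L dW hdW eW dV' hdV') (tensorFrame_ne_zero L dW eW dV' hdW0 hdV'0) χb (borelPlaceMeasure L) (cmFinLocalFamily L e' dV hdV hdV0 (tensorFrame L dW eW dV') (tensorFrame_real L dW hdW eW dV' hdV') (tensorFrame_ne_zero L dW eW dV' hdW0 hdV'0) χb hχbs (borelPlaceMeasure L)) v⟩)
    (Kv : Subgroup (UnitaryGroup.localPi L (IsCMField.complexConj L) (n + n) (hermD L e dV hdV dW hdW) v))
    (hKv : IsCompact (Kv : Set (UnitaryGroup.localPi L (IsCMField.complexConj L) (n + n) (hermD L e dV hdV dW hdW) v))) :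
    FiniteDimensional ℂ (Submodule.span ℂ (Set.range fun k : Kv => fun u : UnitaryGroup.localPi L (IsCMField.complexConj L) (n + n) (hermD L e dV hdV dW hdW) v =>
        b (u * (k : UnitaryGroup.localPi L (IsCMField.complexConj L) (n + n) (hermD L e dV hdV dW hdW) v)))) :=
  FiniteDimensional.span_of_finite ℂ (finite_range_rightTranslate_of_mem_localSWImage_rec L e dV hdV hdV0 dW hdW hdW0 eW e' dV' hdV' hdV'0 hχbs v hb Kv hKv)

end Summit.HodgeConjecture.HodgeConjecture.Cruxes.HLiu418.K2LiuLocalSWSectionKFinite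

end
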